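import Literature.Computability.AlgebraicComplexity.TensorSemiringSpectrum
import Literature.Computability.AlgebraicComplexity.StrassenPreorderRank
import HarnessLib

/-!
# Strassen duality for the asymptotic rank of tensors: `R̃(t) = max_{F ∈ Δ(T)} F(t)` — proved

Topic `Literature/Computability/AlgebraicComplexity`; sibling of `AsymptoticSpectrum.lean`, whose
named fact `strassen_duality_asymptoticRank K` (Christandl–Vrana–Zuiddam, JAMS 36 (2023) =
arXiv:1709.07851, Prop. 1.6 for the semiring `X = T` of all 3-tensors over the field `K`;
V. Strassen, J. reine angew. Math. 384 (1988), Thm. 3.8) is DISCHARGED here: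
`strassen_duality_asymptoticRank_holds`.

## The printed claim and the proof architecture

CVZ Prop. 1.6: "Let `X ⊆ T` be a semiring. Let `(Δ, φ)` be an asymptotic spectrum of `X`. Let
`a ∈ X`. Then `Q̃(a) = min_{ξ ∈ Δ} φ(a)(ξ)` and `R̃(a) = max_{ξ ∈ Δ} φ(a)(ξ)`", which "follows from
(the spectral theorem 1.1) (see [Strassen 1988])"; no proof is printed there. The tree's statement
is the `R̃` half for `X = T`: every universal spectral point `F` (CVZ §1.2, p. 7:
`IsUniversalSpectralPoint`) has `F(t) ≤ R̃(t)`, and some `F` attains `F(t) = R̃(t)`.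

The proof assembled here is Zuiddam's exposition of Strassen's theory (PhD thesis 2018, Ch. 2),
formalised in `StrassenPreorder`, `StrassenPreorderClosure`, `StrassenPreorderMaximal`,
`StrassenPreorderHom`, `StrassenPreorderRank` (abstract Strassen-preordered semirings: asymptotic
preorder, maximal/total extensions by Zorn, the monotone homomorphism of a total preorder, and the
duality `R̃(a) = max_φ φ(a)` — Zuiddam Cor. 2.13 — for elements `a ⩾ 1`), applied to the semiring
`T(K)` of tensors modulo restriction-equivalence (`TensorSemiring.lean`), which is Strassen-preordered
by restriction, with the universal spectral points of CVZ corresponding exactly to the spectral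
points of `T(K)` (`TensorSemiringSpectrum.lean`: `TensorClass.isStrassenPreorder`,
`TensorClass.isSpectralPoint_eval`, `TensorClass.isUniversalSpectralPoint_spectralMapOf`). The last
entries of the dictionary are proved here: `[t] ≤ r ↔ R(t) ≤ r`, so the abstract rank of `[t]` is
the tensor rank, and — since `[t]^N = [t^{⊗N}]` — the abstract asymptotic rank of `[t]` is
`R̃(t) = asymptoticRank t`. A nonzero tensor satisfies `⟨1⟩ ≤ t`, the hypothesis of Cor. 2.13; the
zero tensor has `R̃ = 0 = F(0)`.

## Main statements

* `TensorClass.mk_le_natCast_iff` — `[t] ≤ r ↔ R(t) ≤ r` (BCS (14.19));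
  `TensorClass.rankOf_mk` — `rankOf (· ≤ ·) [t] = R(t)`; `TensorClass.asympRankOf_mk` —
  `asympRankOf (· ≤ ·) [t] = R̃(t)`.
* `strassen_duality_asymptoticRank_holds K : strassen_duality_asymptoticRank K`.

## References

* M. Christandl, P. Vrana, J. Zuiddam, *Universal points in the asymptotic spectrum of tensors*,
  J. Amer. Math. Soc. 36 (2023) 31–79, Prop. 1.6, §1.2. [ChristandlVranaZuiddam2023]
* V. Strassen, *The asymptotic spectrum of tensors*, J. reine angew. Math. 384 (1988) 102–152,
  Thm. 3.8. [Strassen1988]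
* J. Zuiddam, *Algebraic complexity, asymptotic spectra and entanglement polytopes*, PhD thesis,
  University of Amsterdam (2018), §2.8, Cor. 2.13. [Zuiddam2018]
* P. Bürgisser, M. Clausen, M. A. Shokrollahi, *Algebraic Complexity Theory* (1997), (14.19).
  [BurgisserClausenShokrollahi1997]
-/

noncomputable section

open scoped BigOperators

namespace Literature.Computability.AlgebraicComplexity

universe u

namespace TensorClass

section Rank

variable {K : Type u} [CommSemiring K]
variable {ι κ μ : Type*}

/-- **`[t] ≤ r ↔ R(t) ≤ r`** (`r ∈ ℕ`): `t ≤ ⟨r⟩` iff `t` has rank at most `r` (BCS (14.19):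
"`R(t) ≤ r ⟺ t ≤ ⟨r⟩`"; `⇐` is `tensorRestrictsTo_unitTensor_of_tensorRank_le`, `⇒` is rank
monotonicity under restriction and `R(⟨r⟩) ≤ r`, `⟨r⟩ = ∑ᵢ eᵢ ⊗ eᵢ ⊗ eᵢ`). [cite: BurgisserClausenShokrollahi1997, (14.19)] -/
theorem mk_le_natCast_iff [Fintype ι] [Fintype κ] [Fintype μ] (t : ι → κ → μ → K) (r : ℕ) :
    mk t ≤ (r : TensorClass K) ↔ tensorRank t ≤ r := by
  rw [natCast_eq_mk, mk_le_mk_iff]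
  refine ⟨fun h => h.tensorRank_le.trans ?_, tensorRestrictsTo_unitTensor_of_tensorRank_le t⟩
  classical
  refine tensorRank_le_of_eq_sum (fun i a => if a = i then 1 else 0)
    (fun i b => if b = i then 1 else 0) (fun i c => if c = i then 1 else 0) ?_
  funext a b c
  rw [sum_triad_apply, unitTensor_apply,
    Finset.sum_eq_single a (fun i _ hi => by simp [Ne.symm hi]) (by simp)]
  by_cases hab : a = b
  · subst hab
    by_cases hac : a = c
    · subst hac; simp
    · simp [hac, Ne.symm hac]
  · simp [hab, Ne.symm hab]

/-- **The abstract rank of `[t]` is the tensor rank `R(t)`** (Zuiddam 2018, §2.8: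
`R(a) = min {r ∈ ℕ : a ⩽ r}`; CVZ §1.1: `R(f) = min {r : f ≤ ⟨r⟩}`). [cite: Zuiddam2018, §2.8] -/
theorem rankOf_mk [Fintype ι] [Fintype κ] [Fintype μ] (t : ι → κ → μ → K) :
    rankOf (fun x y : TensorClass K => x ≤ y) (mk t) = tensorRank t := by
  unfold rankOf
  have hset : {r : ℕ | mk t ≤ (r : TensorClass K)} = {r : ℕ | tensorRank t ≤ r} := by
    ext r
    exact mk_le_natCast_iff t r
  rw [hset]
  refine le_antisymm (Nat.sInf_le (show tensorRank t ≤ tensorRank t from le_rfl)) ?_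
  exact Nat.sInf_mem (s := {r : ℕ | tensorRank t ≤ r})
    ⟨tensorRank t, show tensorRank t ≤ tensorRank t from le_rfl⟩

/-- **The abstract asymptotic rank of `[t]` is `R̃(t) = asymptoticRank t`** (CVZ §1.1; Zuiddam
§2.8), term by term: `[t]^N = [t^{⊗N}]` (`mk_pow`) and `rankOf [s] = R(s)`. [cite: Zuiddam2018, §2.8] -/
theorem asympRankOf_mk [Fintype ι] [Fintype κ] [Fintype μ] (t : ι → κ → μ → K) :
    asympRankOf (fun x y : TensorClass K => x ≤ y) (mk t) = asymptoticRank t := by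
  unfold asympRankOf asymptoticRank
  congr 1
  funext N
  rw [mk_pow, rankOf_mk]

end Rank

end TensorClass

/-! ## The duality -/

section Duality

variable (K : Type u) [Field K]

/-- **Strassen duality for the asymptotic rank** (Christandl–Vrana–Zuiddam 2023, Prop. 1.6 for
`X = T`; Strassen 1988, Thm. 3.8): for every 3-tensor `t` over a field with finite index types,
every universal spectral point satisfies `F(t) ≤ R̃(t)` and some universal spectral point attains
`F(t) = R̃(t)`, i.e. `R̃(t) = max_{F ∈ Δ(T)} F(t)`. Discharges the named fact
`strassen_duality_asymptoticRank`. [cite: ChristandlVranaZuiddam2023, Prop. 1.6] -/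
theorem strassen_duality_asymptoticRank_holds : strassen_duality_asymptoticRank K := by
  intro ι κ μ _ _ _ t
  have hS := TensorClass.isStrassenPreorder K
  refine ⟨fun F hF => ?_, ?_⟩
  · have hφ := TensorClass.isSpectralPoint_eval hF
    rw [← TensorClass.eval_mk hF t, ← TensorClass.asympRankOf_mk]
    exact hφ.le_asympRankOf hS _
  · have key : ∃ φ : TensorClass K → ℝ, IsSpectralPoint (fun x y : TensorClass K => x ≤ y) φ ∧
        φ (TensorClass.mk t) = asympRankOf (fun x y : TensorClass K => x ≤ y) (TensorClass.mk t) := by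
      by_cases ht : t = 0
      · refine hS.exists_isSpectralPoint_eq_asympRankOf_of_le_zero _ ?_
        show TensorClass.mk t ≤ 0
        rw [ht, TensorClass.mk_zero]
      · exact hS.exists_isSpectralPoint_eq_asympRankOf _ (TensorClass.one_le_mk ht)
    obtain ⟨φ, hφ, hφt⟩ := key
    refine ⟨TensorClass.spectralMapOf φ, TensorClass.isUniversalSpectralPoint_spectralMapOf hφ, ?_⟩
    rw [TensorClass.spectralMapOf_apply, hφt, TensorClass.asympRankOf_mk]

end Duality

end Literature.Computability.AlgebraicComplexity

end
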